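import Literature.IUT.HodgeTheaters.PuncturedEllipticArrowModelUnorientedModLCuspLaws
import HarnessLib

/-!
# The `ε⁰`-ramification clause stays INDEPENDENT after the «hA ↦ hL» swap: the six `Δ_ε`-level laws do not decide it

[IUTchI] §1 pp. 37–39, proof of Corollary 1.2 p. 39: «the decomposition groups of `ε⁰, ε′, ε″` … whose image in
`Gal(X̲→/X̲) = Π_X̲/Π_{X̲→}` is nontrivial» [cite: Mochizuki2012, IUTchI Cor 1.2 p.39] (D-0012 claim key, status
disputed).  PROOF-ONLY, WITNESS-class (two finite models); cell abc-iut, seat abc-iut-L5-t1 (gen 6), sequel of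
`PuncturedEllipticArrowModelUnorientedDatum.lean` (p437242: independence of the clause from the typed §1 record
`ArrowCoveringClaims ∧ Rmk121 ∧ ArrowOpenClaims ∧ CuspGalois ∧` numerics) and of
`PuncturedEllipticArrowModelUnorientedModLCuspLaws.lean` (p455483: the laws `ModLCuspLaws` hold at the unoriented
model).

WHY.  The Layer-5 certificate now binds `hL : ModLCuspLaws` in place of `hA : ArrowCoveringClaims` (abc-iut-L5-lead
RULINGS #72 (1), swap recipe; `hA` is a theorem of `CuspGalois + ModLCuspLaws`, p448117), while abc-iut-L5-d4's
Cor. 1.2 assembly keeps the printed `ε⁰`-clause as the binder `h0 : ¬ D.inertia D.ε0 ≤ D.piXarrow` (GAP-LEDGER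
G-L5d4g6-1).  Census question answered here IN THE KERNEL: does the new binder `hL` (jointly with everything else
typed in §1) decide `h0`?  NO —
* `exists_model_laws_inertia_ε0_le` — the UNORIENTED model `ArrowModel.udatum` carries `CuspGalois`, satisfies
  `ModLCuspLaws` (p455483), `ArrowCoveringClaims`, `Rmk121`, `ArrowOpenClaims`, the Def. 3.1 (d) numerics, AND
  `I_{ε⁰} ⊆ Π_{X̲→}`;
* `exists_model_laws_not_inertia_ε0_le` — the genuine model `ArrowModel.datum` carries/satisfies the same list
  (p448735) AND `¬ I_{ε⁰} ⊆ Π_{X̲→}`;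
* `inertia_ε0_clause_independent_of_laws`, `not_forall_laws_inertia_ε0_ramified` — hence `h0` is independent of
  `{CuspGalois, ModLCuspLaws, ArrowCoveringClaims, Rmk121, ArrowOpenClaims, numerics}` at every admissible `l`; the
  deciding print input remains the ORIENTED surface relation (gen)(rel)(inv) of cusp inertia (positive half:
  `CuspGalois.not_inertia_ε0_le_piXarrow_of_modLCuspLaws`, p449018; étale-π₁-of-curves structure, INTERFACE,
  TODO-merge abc-iut-L4-t1), so the swap `hA ↦ hL` changes nothing for `h0`'s status as a binder.
No `def`, no instance, symbolic `l`; axioms standard.  Witnessed ≠ endorsed; finite models, `G_k = 1`.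

HONEST FRAMING: nothing here asserts abc proved or refuted or takes a side on [IUTchIII] Cor. 3.12; a model
witnesses consistency of OUR binders only.
-/

namespace Literature.IUT.HodgeTheaters

namespace PuncturedEllipticData

namespace ArrowModel

variable (l : ℕ)

/-- **JOINT MODEL of the laws WITH `I_{ε⁰} ⊆ Π_{X̲→}`** (the unoriented `udatum`): for every `l ≥ 5` prime to `6`,
a `PuncturedEllipticData` with that `l` carrying `CuspGalois`, satisfying `ModLCuspLaws`, `ArrowCoveringClaims`,
`Rmk121`, `ArrowOpenClaims`, the Def. 3.1 (d) numerics — and with the zero cusp UNRAMIFIED in `X̲→ → X̲`.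
([IUTchI] Cor 1.2 p.39) [claim: Mochizuki2012, status: disputed] -/
theorem exists_model_laws_inertia_ε0_le (h5 : 5 ≤ l) (h6 : Nat.Coprime l 6) :
    ∃ D : PuncturedEllipticData.{0}, D.l = l ∧ Nonempty D.CuspGalois ∧ D.ModLCuspLaws ∧ D.ArrowCoveringClaims ∧
      D.Rmk121 ∧ D.ArrowOpenClaims ∧ D.PiXbar.relIndex D.PiX = l ∧ D.PiXbar.relIndex D.PiCbar = 2 ∧
      ¬ D.PiCbar ≤ D.PiX ∧ Function.Surjective (D.E.aug.toMonoidHom.comp D.PiXbar.subtype) ∧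
      D.inertia D.ε0 ≤ D.piXarrow :=
  ⟨udatum l h5 h6, rfl, ⟨udatumCuspGalois h5 h6⟩, modLCuspLaws_udatum h5 h6, udatum_arrowCoveringClaims h5 h6,
    udatum_rmk121 h5 h6, udatum_arrowOpenClaims h5 h6, (udatum_numerics h5 h6).1, (udatum_numerics h5 h6).2.1,
    (udatum_numerics h5 h6).2.2.1, (udatum_numerics h5 h6).2.2.2, udatum_inertia_ε0_le_piXarrow h5 h6⟩

/-- **JOINT MODEL of the laws WITH `¬ I_{ε⁰} ⊆ Π_{X̲→}`** (the genuine `datum`). ([IUTchI] Cor 1.2 p.39)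
[claim: Mochizuki2012, status: disputed] -/
theorem exists_model_laws_not_inertia_ε0_le (h5 : 5 ≤ l) (h6 : Nat.Coprime l 6) :
    ∃ D : PuncturedEllipticData.{0}, D.l = l ∧ Nonempty D.CuspGalois ∧ D.ModLCuspLaws ∧ D.ArrowCoveringClaims ∧
      D.Rmk121 ∧ D.ArrowOpenClaims ∧ D.PiXbar.relIndex D.PiX = l ∧ D.PiXbar.relIndex D.PiCbar = 2 ∧
      ¬ D.PiCbar ≤ D.PiX ∧ Function.Surjective (D.E.aug.toMonoidHom.comp D.PiXbar.subtype) ∧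
      ¬ D.inertia D.ε0 ≤ D.piXarrow :=
  ⟨datum l h5 h6, rfl, ⟨cuspGalois h5 h6⟩, modLCuspLaws h5 h6, arrowCoveringClaims h5 h6, rmk121 h5 h6,
    arrowOpenClaims h5 h6, (thetaNumerics h5 h6).1, (thetaNumerics h5 h6).2.1, (thetaNumerics h5 h6).2.2.1,
    (thetaNumerics h5 h6).2.2.2, datum_not_inertia_ε0_le_piXarrow h5 h6⟩

/-- **INDEPENDENCE of the `ε⁰`-ramification clause from the laws** (GAP-LEDGER G-L5d4g6-1 after the «hA ↦ hL»
swap): `CuspGalois ∧ ModLCuspLaws ∧ ArrowCoveringClaims ∧ Rmk121 ∧ ArrowOpenClaims ∧` the Def. 3.1 (d) numerics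
decides NEITHER `¬ I_{ε⁰} ⊆ Π_{X̲→}` (the binder `h0`) NOR its negation: both have models at every admissible `l`.
([IUTchI] Cor 1.2 p.39) [claim: Mochizuki2012, status: disputed] -/
theorem inertia_ε0_clause_independent_of_laws (h5 : 5 ≤ l) (h6 : Nat.Coprime l 6) :
    (∃ D : PuncturedEllipticData.{0}, D.l = l ∧ Nonempty D.CuspGalois ∧ D.ModLCuspLaws ∧ D.ArrowCoveringClaims ∧
      D.Rmk121 ∧ D.ArrowOpenClaims ∧ D.PiXbar.relIndex D.PiX = l ∧ D.PiXbar.relIndex D.PiCbar = 2 ∧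
      ¬ D.PiCbar ≤ D.PiX ∧ Function.Surjective (D.E.aug.toMonoidHom.comp D.PiXbar.subtype) ∧
      D.inertia D.ε0 ≤ D.piXarrow) ∧
    (∃ D : PuncturedEllipticData.{0}, D.l = l ∧ Nonempty D.CuspGalois ∧ D.ModLCuspLaws ∧ D.ArrowCoveringClaims ∧
      D.Rmk121 ∧ D.ArrowOpenClaims ∧ D.PiXbar.relIndex D.PiX = l ∧ D.PiXbar.relIndex D.PiCbar = 2 ∧
      ¬ D.PiCbar ≤ D.PiX ∧ Function.Surjective (D.E.aug.toMonoidHom.comp D.PiXbar.subtype) ∧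
      ¬ D.inertia D.ε0 ≤ D.piXarrow) :=
  ⟨exists_model_laws_inertia_ε0_le l h5 h6, exists_model_laws_not_inertia_ε0_le l h5 h6⟩

/-- **The clause is NOT a theorem of the laws**: it is false that every `PuncturedEllipticData` carrying `CuspGalois`
and satisfying `ModLCuspLaws`, `ArrowCoveringClaims`, `Rmk121`, `ArrowOpenClaims` and the numerics has
`¬ I_{ε⁰} ⊆ Π_{X̲→}` (counter-model at `l = 5`). ([IUTchI] Cor 1.2 p.39) [claim: Mochizuki2012, status: disputed] -/
theorem not_forall_laws_inertia_ε0_ramified :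
    ¬ ∀ D : PuncturedEllipticData.{0}, Nonempty D.CuspGalois → D.ModLCuspLaws → D.ArrowCoveringClaims →
      D.Rmk121 → D.ArrowOpenClaims → D.PiXbar.relIndex D.PiX = D.l → D.PiXbar.relIndex D.PiCbar = 2 →
      ¬ D.PiCbar ≤ D.PiX → ¬ D.inertia D.ε0 ≤ D.piXarrow := by
  intro H
  obtain ⟨D, hl, hC, hL, hA, hR, hO, hX, h2, hn, -, h0⟩ := exists_model_laws_inertia_ε0_le 5 le_rfl (by decide)
  exact H D hC hL hA hR hO (by rw [hX, hl]) h2 hn h0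

end ArrowModel

end PuncturedEllipticData

end Literature.IUT.HodgeTheaters
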